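import Mathlib
import HarnessLib
import Literature.MathematicalPhysics.QuantumManyBody.GroundState
import Literature.MathematicalPhysics.QuantumManyBody.LiebYngvasonCellMethod
import Summits.AtomisticToContinuum.BoseEinsteinCondensation.Theses.BECHeatBathGap
import Summits.AtomisticToContinuum.BoseEinsteinCondensation.Theorems.BECHeatBathGapParticleTensorisationATClosure

/-!
# Crux `ParticleTensorisation` (stmt-AtomisticToContinuum-14367) — what the crux pins:
# every `L²`-cluster point of its witnesses is a ground state satisfying the AT clause

`ParticleTensorisation` (route `BECHeatBathGap`, item A1) asks, eventually in `N` and at EVERY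
absolute slack `δ > 0`, for SOME `δ`-near-minimiser `Θ` of the Dirichlet `N`-body energy whose Born
law satisfies the division-free approximate-tensorisation (AT) clause with an `N`-uniform constant
`C`. This file draws the consequence that every analysis of the crux has used informally
(`Cruxes/ParticleTensorisation/Lines/registered-dead*.md`, leads c1–c7): taking the witnesses at
slacks `(n+1)⁻¹` gives a minimising sequence `Θₙ`, and

* `particleTensorisation_witness_limits` — along every subsequence, every `L²`-limit `Ψ` of the
  witnesses satisfies the SAME AT clause on the box (by `ATClause.clause_of_tendsto`: the clause is
  closed under `L²` limits of the amplitude; the limit is automatically normalised and carried by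
  the box);
* `isGroundState_of_witness_limit` — and every such limit that is an admissible representative
  (measurable, Dirichlet, Bose-symmetric) is a ground state in the sense of
  `Literature.MathematicalPhysics.QuantumManyBody.BoseGas.IsGroundState`
  (by `IsGroundState.of_tendstoL2`, the energies tending to `E₀`).

So the existential typing of A1 ("SOME near-minimiser at every slack") does not weaken it below an
`N`-uniform heat-bath Poincaré inequality for the Born law of a true Dirichlet ground state
whenever near-minimisers are precompact in `L²` (Rellich; not asserted in the tree) — the form in
which a refutation of the crux may be run on `Ψ₀` directly, and the reason the witness stub of line
`registered` is crux-sized. Tools/consequences only (`--supports`); the crux is not touched.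
-/

noncomputable section

namespace Summit.AtomisticToContinuum.BoseEinsteinCondensation.Theorems.ATClause

open MeasureTheory Function Finset Set Filter
open scoped ENNReal Topology
open Literature.MathematicalPhysics.QuantumManyBody.BoseGas

variable {N : ℕ}

/-- An `L²`-limit of trial states in the box `Λ_L^N` carries all its mass on the box:
`∫_{Λ_L^N} |Ψ|² = 1` (the trial states vanish off the box, so `∫_{(Λ_L^N)ᶜ} |Ψ|² ≤ ‖Φₙ - Ψ‖₂² → 0`,
and `‖Ψ‖₂ = 1` by `TendstoL2.lintegral_nnnorm_sq_eq_one`). [folklore] -/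
theorem setLIntegral_boxN_eq_one_of_tendstoL2 {L : ℝ} {Φ : ℕ → TrialState N L}
    {Ψ : Config N → ℂ} (h : TendstoL2 Φ Ψ) (hΨ : Measurable Ψ) :
    ∫⁻ X in boxN N L, (‖Ψ X‖₊ : ℝ≥0∞) ^ 2 = 1 := by
  have h1 : ∫⁻ X, (‖Ψ X‖₊ : ℝ≥0∞) ^ 2 = 1 :=
    h.lintegral_nnnorm_sq_eq_one hΨ.aestronglyMeasurable
  have hcompl : ∫⁻ X in (boxN N L)ᶜ, (‖Ψ X‖₊ : ℝ≥0∞) ^ 2 = 0 := by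
    refine le_antisymm (ge_of_tendsto h (Eventually.of_forall fun n => ?_)) bot_le
    calc ∫⁻ X in (boxN N L)ᶜ, (‖Ψ X‖₊ : ℝ≥0∞) ^ 2
        = ∫⁻ X in (boxN N L)ᶜ, (‖(Φ n).ψ X - Ψ X‖₊ : ℝ≥0∞) ^ 2 := by
          refine setLIntegral_congr_fun (measurableSet_boxN N L).compl fun X hX => ?_
          rw [(Φ n).eq_zero X hX, zero_sub, nnnorm_neg]
      _ ≤ ∫⁻ X, (‖(Φ n).ψ X - Ψ X‖₊ : ℝ≥0∞) ^ 2 := setLIntegral_le_lintegral _ _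
  rw [← lintegral_add_compl _ (measurableSet_boxN N L), hcompl, add_zero] at h1
  exact h1

/-- **What `ParticleTensorisation` pins.** If the crux holds then for every admissible `v` there
are `ρ₀, C > 0` such that for `0 < ρ < ρ₀` and all large `N` there is a minimising sequence of
Dirichlet trial states `Θₙ` (energy `≤ E₀ + (n+1)⁻¹`, each an AT witness of the crux) such that
along EVERY subsequence, EVERY measurable `L²`-limit `Ψ` of the `Θₙ` satisfies the division-free
approximate-tensorisation clause on the box `Λ^N` with the same constant `C`
(the clause is closed under `L²` limits, `ATClause.clause_of_tendsto`; the limit has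
`∫_{Λ^N} |Ψ|² = 1`). [folklore] -/
theorem particleTensorisation_witness_limits
    (h : Summit.AtomisticToContinuum.BoseEinsteinCondensation.Theses.BECHeatBathGap.ParticleTensorisation)
    (v : ℝ → ℝ≥0∞) (hv : IsRepulsiveFiniteRange v) :
    ∃ ρ₀ : ℝ, 0 < ρ₀ ∧ ∃ C : ℝ, 0 < C ∧ ∀ ρ : ℝ, 0 < ρ → ρ < ρ₀ → ∀ᶠ N : ℕ in atTop,
      ∃ Θ : ℕ → TrialState N (sideLength ρ (N + 1)),
        (∀ n, energy v (Θ n) ≤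
          groundStateEnergy v N (sideLength ρ (N + 1)) + ((n : ℝ≥0∞) + 1)⁻¹) ∧
        ∀ φ : ℕ → ℕ, StrictMono φ → ∀ Ψ : Config N → ℂ, Measurable Ψ →
          TendstoL2 (fun n => Θ (φ n)) Ψ →
          ∀ (F : (Fin N → EuclideanSpace ℝ (Fin 3)) → ℂ)
            (g : Fin N → (Fin N → EuclideanSpace ℝ (Fin 3)) → ℂ), Measurable F →
            (∀ i, Measurable (g i)) → (∃ M : ℝ, ∀ X, ‖F X‖ ≤ M ∧ ∀ i, ‖g i X‖ ≤ M) →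
            (∀ i X x, g i (Function.update X i x) = g i X) →
            ∃ c : ℂ, (∫⁻ X in boxN N (sideLength ρ (N + 1)), (‖F X - c * Ψ X‖₊ : ℝ≥0∞) ^ 2) ≤
              ENNReal.ofReal C * ∑ i : Fin N, ∫⁻ X in boxN N (sideLength ρ (N + 1)),
                (‖F X - g i X * Ψ X‖₊ : ℝ≥0∞) ^ 2 := by
  obtain ⟨ρ₀, hρ₀, C, hC, H⟩ := h v hv
  refine ⟨ρ₀, hρ₀, C, hC, fun ρ hρ hρlt => ?_⟩
  filter_upwards [H ρ hρ hρlt] with N hN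
  have hδ : ∀ n : ℕ, (0 : ℝ≥0∞) < ((n : ℝ≥0∞) + 1)⁻¹ := fun n =>
    ENNReal.inv_pos.2 (ENNReal.add_ne_top.2 ⟨ENNReal.natCast_ne_top n, ENNReal.one_ne_top⟩)
  choose Θ hΘ using fun n : ℕ => hN _ (hδ n)
  refine ⟨Θ, fun n => (hΘ n).1, ?_⟩
  intro φ hφ Ψ hΨ hT F g hF hg hFg hupd
  haveI : IsFiniteMeasure (volume.restrict (boxN N (sideLength ρ (N + 1)))) :=
    isFiniteMeasure_restrict.2 (volume_boxN_lt_top N _).ne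
  have h1 : ∫⁻ X in boxN N (sideLength ρ (N + 1)), (‖Ψ X‖₊ : ℝ≥0∞) ^ 2 = 1 :=
    setLIntegral_boxN_eq_one_of_tendstoL2 hT hΨ
  have hT' : Tendsto (fun n => ∫⁻ X, (‖(Θ (φ n)).ψ X - Ψ X‖₊ : ℝ≥0∞) ^ 2) atTop (𝓝 0) := hT
  have hlim : Tendsto (fun n => ∫⁻ X in boxN N (sideLength ρ (N + 1)),
      (‖(Θ (φ n)).ψ X - Ψ X‖₊ : ℝ≥0∞) ^ 2) atTop (𝓝 0) :=
    tendsto_of_tendsto_of_tendsto_of_le_of_le tendsto_const_nhds hT' (fun _ => bot_le)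
      fun n => setLIntegral_le_lintegral (boxN N (sideLength ρ (N + 1)))
        (fun X => (‖(Θ (φ n)).ψ X - Ψ X‖₊ : ℝ≥0∞) ^ 2)
  exact clause_of_tendsto (volume.restrict (boxN N (sideLength ρ (N + 1))))
    (Θ := fun n => (Θ (φ n)).ψ)
    (fun n => (Θ (φ n)).contDiff.continuous.measurable) hΨ (by rw [h1]; exact one_ne_zero)
    (by rw [h1]; exact ENNReal.one_ne_top) hlim (fun n => (hΘ (φ n)).2) F g hF hg hFg hupd

/-- **Witness limits are ground states.** In the situation of
`particleTensorisation_witness_limits` (or for any sequence of trial states with energies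
`≤ E₀ + (n+1)⁻¹`), an `L²`-limit along a subsequence that is an admissible representative —
measurable, Dirichlet, Bose-symmetric — is a ground state (`IsGroundState`), provided `E₀ < ⊤`:
the energies along the subsequence tend to `E₀`, so `IsGroundState.of_tendstoL2` applies. Together
with the previous theorem: the crux forces the AT clause, with its `N`-uniform constant, on ground
states themselves. [folklore] -/
theorem isGroundState_of_witness_limit {v : ℝ → ℝ≥0∞} {L : ℝ} {Θ : ℕ → TrialState N L}
    (hΘ : ∀ n, energy v (Θ n) ≤ groundStateEnergy v N L + ((n : ℝ≥0∞) + 1)⁻¹)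
    (hE : groundStateEnergy v N L ≠ ⊤) {φ : ℕ → ℕ} (hφ : StrictMono φ) {Ψ : Config N → ℂ}
    (hm : Measurable Ψ) (h0 : ∀ X, X ∉ boxN N L → Ψ X = 0)
    (hs : ∀ (σ : Equiv.Perm (Fin N)) (X : Config N), Ψ (X ∘ σ) = Ψ X)
    (hT : TendstoL2 (fun n => Θ (φ n)) Ψ) : IsGroundState v L Ψ := by
  refine IsGroundState.of_tendstoL2 hm h0 hs hE hT ?_
  -- the energies along the subsequence are squeezed between `E₀` and `E₀ + (φ n + 1)⁻¹ → E₀`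
  have hnat : Tendsto (fun n => ((φ n : ℕ) : ℝ≥0∞) + 1) atTop (𝓝 ⊤) := by
    have h1 : Tendsto (fun n => ((φ n : ℕ) : ℝ≥0∞)) atTop (𝓝 ⊤) :=
      ENNReal.tendsto_nat_nhds_top.comp hφ.tendsto_atTop
    simpa using h1.add (tendsto_const_nhds (x := (1 : ℝ≥0∞)))
  have hinv : Tendsto (fun n => (((φ n : ℕ) : ℝ≥0∞) + 1)⁻¹) atTop (𝓝 0) := by
    simpa using tendsto_inv_iff.2 hnat
  have hup : Tendsto (fun n => groundStateEnergy v N L + (((φ n : ℕ) : ℝ≥0∞) + 1)⁻¹) atTop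
      (𝓝 (groundStateEnergy v N L)) := by
    simpa using (tendsto_const_nhds (x := groundStateEnergy v N L)).add hinv
  calc liminf (fun n => energy v (Θ (φ n))) atTop
      ≤ liminf (fun n => groundStateEnergy v N L + (((φ n : ℕ) : ℝ≥0∞) + 1)⁻¹) atTop :=
        liminf_le_liminf (Eventually.of_forall fun n => hΘ (φ n))
    _ = groundStateEnergy v N L := hup.liminf_eq

end Summit.AtomisticToContinuum.BoseEinsteinCondensation.Theorems.ATClause
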